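import Mathlib
import Summits.HodgeConjecture.HodgeConjecture.Theorems.HodgeLocusCensusUnitColumnRank
import Summits.HodgeConjecture.HodgeConjecture.Theorems.HodgeLocusCensusModelNonJumpC1All

/-!
# Hodge-locus census — THE RANK 'PAPER STEP' (γ) INSTANTIATED: `×δ` ON THE MODEL MEMBER `F_{d;1,k′}` HAS FULL ROW RANK FOR EVERY `k′ ≥ 3`, `d ≥ 5`
(def-free, certificate-free, theorem-only helper of `stmt-HodgeConjecture-16267`; pub-hlocus, seat ivhs-2 = ENGINE B, gen 44, item B44-R′;
record `pub-hlocus-ivhs-2/gen44/ENGINEB-g44.md`; companion of the ENGINE B anchors `HodgeLocusCensusUnitColumnRank.lean` (gen 43: the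
general rank lemmas over an arbitrary field, whose (γ) `rank_eq_card_of_covering_unit_cols` is APPLIED here by name) and
`HodgeLocusCensusModelNonJumpC1All.lean` (gen 31: THEOREM K-MODEL, `c′ = 1`, every `k′ ≥ 3`, `d ≥ 5`, whose `colR`, `covered_all`,
`column_unit_or_zero` are APPLIED here by name), with the bases `basisL`, `sdeg`, `tdeg` of `HodgeLocusCensusModelNonJumpC1.lean` (gen 31);
nothing of theirs is restated.)

Setting (the anchors').  Cell `(2k′, d, k′-1)`, `c′ = 1`; plane algebra `B = K[x_1..x_{k′}]/(x_1^{d-1}, …, x_{k′}^{d-1})`, restricted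
transition form `δ = Σ_i x_i^{d-2}`, Kronecker index `ρ = rank(×δ : B_{s-d} → B_{t-d})`, `s - d = k′(d-2) - d`, `t - d = k′(d-2) - 2`.
`ModelNonJumpC1All` kernel-checks, with `k′` and `d` symbolic, the COLUMN SUPPORTS of `×δ` on the monomial basis (`colR d m` = the exponent
vectors of the surviving products `x_i^{d-2}·x^m`, one for each zero entry of `m`, each with coefficient `1`): every target monomial is the unit
column of some source monomial (`covered_all`) and every column is a unit vector or zero (`column_unit_or_zero`) — and then concludes
`ρ(F_{d;1,k′}) = dim B_{t-d}` by the 'paper step' (γ) "a 0/1 matrix whose nonzero columns are unit vectors covering every row has full row rank",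
which `UnitColumnRank` proved as the general lemma `rank_eq_card_of_covering_unit_cols` while leaving THIS instance untreated (its docstring:
"its index types are exponent lists of symbolic length").

This file treats it, over an ARBITRARY field `K`, for EVERY `k′ = k ≥ 3` and EVERY `d ≥ 5` at once (one public theorem, `k` and `d` symbolic):
* INDEX TYPES = exponent functions.  Rows (the monomial basis of `B_{t-d}`) are `{v : Fin k → Fin (d-1) // Σ_i v_i + 2 = k(d-2)}`, columns
  (the basis of `B_{s-d}`) are `{m : Fin k → Fin (d-1) // Σ_i m_i + d = k(d-2)}` (an exponent `< d-1` IS the truncation `x_i^{d-1} = 0`); the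
  entry at `(v, m)` is `1` if the exponent list `List.ofFn v` occurs in the anchor's column list `colR d (List.ofFn m)` and `0` otherwise
  (anchor 168's LAYER B convention).  BRIDGE: `ofFn_entries_le`, `ofFn_length_sum`, `eq_of_ofFn_eq`, `exists_fn_of_list` (exponent functions
  ↔ the exponent lists of the anchor's hypotheses: length `k`, entries `≤ d-2`, injectively); `mem_basisL_iff` (the companion's `basisL d k n`
  IS the set of exponent lists of length `k`, entries `≤ d-2`, degree `n` — all `d, k, n`), `basisL_nodup`, `mem_basisL_target_iff` /
  `mem_basisL_source_iff` (the row/column index types enumerate `basisL d k (tdeg d k)` / `basisL d k (sdeg d k)` exactly, via `List.ofFn`);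
  `indicator_eq_count` (on a source monomial `colR` is empty or a singleton, so the indicator entry equals the multiplicity of the row
  monomial in `colR`, i.e. the coefficient).
* (γ) INSTANCE `rank_mulDelta_modelNonJumpC1All`: that matrix has `Matrix.rank = Fintype.card rows` (FULL ROW RANK: `ρ(F_{d;1,k′}) = dim B_{t-d}`),
  for every field, every `k ≥ 3`, every `d ≥ 5` — proof: `covered_all` moved to function coordinates (`exists_unit_col`) supplies, for each row `v`,
  a column `c v` whose column IS the unit vector `e_v`, and `rank_eq_card_of_covering_unit_cols` concludes; `…_count` is the same statement for the
  multiplicity (coefficient) matrix.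
* COUNTS: `card_target` — `dim B_{t-d} = k(k+1)/2` for every `k` and every `d ≥ 4` (the deficiency vector `(d-2-v_i)_i` has total mass `2`:
  `Sym (Fin k) 2`, stars and bars; the companion's `tdim_table` had `k′ = 3,4`, `d = 5..8` by `decide`), hence `length_basisL_target`
  (`(basisL d k (tdeg d k)).length = k(k+1)/2`, every `k ≥ 1`, `d ≥ 4`); `card_target_le_card_source` (`dim B_{t-d} ≤ dim B_{s-d}`, `k ≥ 3`, `d ≥ 5`:
  full row rank needs as many columns) and `rank_eq_min_modelNonJumpC1All` (`ρ = min(dim B_{s-d}, dim B_{t-d}) = k(k+1)/2`, the largest rank a map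
  `B_{s-d} → B_{t-d}` can have); `card_target_examples` re-evaluates three small cases by `decide`.

Scope (said plainly).  Statements about the explicit 0/1 (= coefficient) matrices read off the anchor's column lists `colR`; that this `ρ` is the
rank entering THEOREM K⁼ (`b = H_B(t-d) - ρ`, so `b(F_{d;1,k′}) = 0`: a NON-jump member, every `k′ ≥ 3`, `d ≥ 5`) is the record's seat-proved,
LEAD/referee-read step and stays outside Lean, as in the anchors.  Evidence-class upgrade of a K-MODEL step already of record (the anchor's
CONSEQUENCE paragraph becomes a kernel theorem: this closes the (γ) instance that `UnitColumnRank`'s docstring marks as not treated); no census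
number changes; nothing about Hodge loci beyond the K-MODEL record; nothing about HC.

certified instances and evidence bearing on the general Hodge conjecture; no claim.
-/

set_option linter.dupNamespace false
set_option autoImplicit false

namespace Summit.HodgeConjecture.HodgeConjecture.HodgeLocus.Census.UnitColumnRankC1All

open Summit.HodgeConjecture.HodgeConjecture.HodgeLocus.Census.ModelNonJumpC1 (basisL sdeg tdeg)
open Summit.HodgeConjecture.HodgeConjecture.HodgeLocus.Census.ModelNonJumpC1All (colR covered_all column_unit_or_zero)
open Summit.HodgeConjecture.HodgeConjecture.HodgeLocus.Census.UnitColumnRank (rank_eq_card_of_covering_unit_cols)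

/-! ## Bridge — exponent functions `Fin k → Fin (d-1)` and the anchor's exponent lists -/

/-- the exponent list of an exponent function has entries `≤ d-2` (an exponent `< d-1` is the truncation `x_i^{d-1} = 0`). -/
theorem ofFn_entries_le {k d : ℕ} (f : Fin k → Fin (d - 1)) :
    ∀ x ∈ List.ofFn (fun i => (f i : ℕ)), x ≤ d - 2 := by
  rw [List.forall_mem_ofFn_iff]
  intro i
  have := (f i).2
  omega

/-- … has length `k` and the total degree of the function. -/
theorem ofFn_length_sum {k d : ℕ} (f : Fin k → Fin (d - 1)) :
    (List.ofFn (fun i => (f i : ℕ))).length = k ∧ (List.ofFn (fun i => (f i : ℕ))).sum = ∑ i, (f i : ℕ) := by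
  simp [List.sum_ofFn]

/-- exponent functions with the same exponent list are equal. -/
theorem eq_of_ofFn_eq {k d : ℕ} {f g : Fin k → Fin (d - 1)}
    (h : List.ofFn (fun i => (f i : ℕ)) = List.ofFn (fun i => (g i : ℕ))) : f = g := by
  have := List.ofFn_injective h
  funext i
  exact Fin.ext (congrFun this i)

/-- an exponent list of length `k` with entries `≤ d-2` (`d ≥ 2`) is the exponent list of an exponent function. -/
theorem exists_fn_of_list {k d : ℕ} (hd : 2 ≤ d) (m : List ℕ) (hlen : m.length = k) (hle : ∀ x ∈ m, x ≤ d - 2) :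
    ∃ g : Fin k → Fin (d - 1), List.ofFn (fun i => (g i : ℕ)) = m := by
  refine ⟨fun i => ⟨m[(i : ℕ)]'(by rw [hlen]; exact i.2), by
    have := hle _ (List.getElem_mem (by rw [hlen]; exact i.2)); omega⟩, ?_⟩
  apply List.ext_getElem
  · simp [hlen]
  · intro i h1 h2
    simp

/-! ## Bridge — the index types are the companion's monomial bases `basisL` -/

/-- the companion's monomial basis `basisL d k n` of `B_n` IS the set of exponent lists of length `k`, entries `≤ d-2`, total degree `n`
(all `d, k, n`; induction on `k` along the definition). -/
theorem mem_basisL_iff (d : ℕ) : ∀ (k n : ℕ) (v : List ℕ),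
    v ∈ basisL d k n ↔ (v.length = k ∧ (∀ x ∈ v, x ≤ d - 2) ∧ v.sum = n)
  | 0, n, v => by
      unfold basisL
      constructor
      · intro hv
        split_ifs at hv with h
        · simp only [List.mem_singleton] at hv
          subst hv; subst h; simp
        · simp at hv
      · rintro ⟨hl, -, hs⟩
        have hv : v = [] := List.eq_nil_of_length_eq_zero hl
        subst hv
        simp only [List.sum_nil] at hs
        subst hs
        simp
  | k + 1, n, v => by
      unfold basisL
      simp only [List.mem_flatMap, List.mem_map, List.mem_range]
      constructor
      · rintro ⟨i, hi, w, hw, rfl⟩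
        rw [mem_basisL_iff d k (n - i) w] at hw
        obtain ⟨hl, hle, hs⟩ := hw
        refine ⟨by simp [hl], ?_, ?_⟩
        · intro x hx
          simp only [List.mem_cons] at hx
          rcases hx with rfl | hx
          · omega
          · exact hle x hx
        · simp only [List.sum_cons, hs]
          omega
      · rintro ⟨hl, hle, hs⟩
        cases v with
        | nil => simp at hl
        | cons i w =>
          have hi := hle i (by simp)
          simp only [List.sum_cons] at hs
          refine ⟨i, by omega, w, ?_, rfl⟩
          rw [mem_basisL_iff d k (n - i) w]
          exact ⟨by simpa using hl, fun x hx => hle x (by simp [hx]), by omega⟩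

/-- `basisL` repeats no monomial (all `d, k, n`). -/
theorem basisL_nodup (d : ℕ) : ∀ (k n : ℕ), (basisL d k n).Nodup
  | 0, n => by
      unfold basisL
      split_ifs <;> simp
  | k + 1, n => by
      unfold basisL
      rw [List.nodup_flatMap]
      constructor
      · intro i _
        exact (basisL_nodup d k (n - i)).map (fun a b h => List.cons_injective h)
      · exact (List.nodup_range (n := _)).imp (fun {a b} (hab : a ≠ b) => by
          intro x hxa hxb
          rw [List.mem_map] at hxa hxb
          obtain ⟨w, -, rfl⟩ := hxa
          obtain ⟨w', -, h⟩ := hxb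
          exact hab (List.cons.inj h).1.symm)

/-- the ROW index type enumerates the companion's basis of `B_{t-d}`: the exponent lists of rows are exactly the members of
`basisL d k (tdeg d k)` (`tdeg d k = k(d-2) - 2`; every `k ≥ 1`, `d ≥ 4`). -/
theorem mem_basisL_target_iff (k d : ℕ) (hk : 1 ≤ k) (hd : 4 ≤ d) (L : List ℕ) :
    L ∈ basisL d k (tdeg d k) ↔
      ∃ v : {v : Fin k → Fin (d - 1) // (∑ i, (v i : ℕ)) + 2 = k * (d - 2)}, List.ofFn (fun i => (v.1 i : ℕ)) = L := by
  have h2 : 2 ≤ k * (d - 2) := le_trans (by omega : 2 ≤ 1 * (d - 2)) (Nat.mul_le_mul_right _ hk)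
  rw [mem_basisL_iff]
  constructor
  · rintro ⟨hl, hle, hs⟩
    obtain ⟨g, hg⟩ := exists_fn_of_list (by omega) L hl hle
    have h1 : (List.ofFn (fun i => (g i : ℕ))).sum = ∑ i, (g i : ℕ) := List.sum_ofFn
    rw [hg, hs] at h1
    refine ⟨⟨g, ?_⟩, hg⟩
    rw [← h1]
    unfold tdeg
    omega
  · rintro ⟨v, rfl⟩
    refine ⟨by simp, ofFn_entries_le v.1, ?_⟩
    rw [List.sum_ofFn]
    have := v.2
    unfold tdeg
    omega

/-- the COLUMN index type enumerates the companion's basis of `B_{s-d}`: the exponent lists of columns are exactly the members of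
`basisL d k (sdeg d k)` (`sdeg d k = k(d-2) - d`; every `k ≥ 2`, `d ≥ 4`). -/
theorem mem_basisL_source_iff (k d : ℕ) (hk : 2 ≤ k) (hd : 4 ≤ d) (L : List ℕ) :
    L ∈ basisL d k (sdeg d k) ↔
      ∃ m : {m : Fin k → Fin (d - 1) // (∑ i, (m i : ℕ)) + d = k * (d - 2)}, List.ofFn (fun i => (m.1 i : ℕ)) = L := by
  have h2 : d ≤ k * (d - 2) := le_trans (by omega : d ≤ 2 * (d - 2)) (Nat.mul_le_mul_right _ hk)
  rw [mem_basisL_iff]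
  constructor
  · rintro ⟨hl, hle, hs⟩
    obtain ⟨g, hg⟩ := exists_fn_of_list (by omega) L hl hle
    have h1 : (List.ofFn (fun i => (g i : ℕ))).sum = ∑ i, (g i : ℕ) := List.sum_ofFn
    rw [hg, hs] at h1
    refine ⟨⟨g, ?_⟩, hg⟩
    rw [← h1]
    unfold sdeg
    omega
  · rintro ⟨m, rfl⟩
    refine ⟨by simp, ofFn_entries_le m.1, ?_⟩
    rw [List.sum_ofFn]
    have := m.2
    unfold sdeg
    omega

/-! ## Coverage in function coordinates and the (γ) instance -/

/-- COVERAGE (the anchor's `covered_all` in function coordinates), every `k ≥ 3`, `d ≥ 5`: every row `v` is the unit column `[v]` of some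
column `m`. -/
theorem exists_unit_col (k d : ℕ) (hk : 3 ≤ k) (hd : 5 ≤ d)
    (v : {v : Fin k → Fin (d - 1) // (∑ i, (v i : ℕ)) + 2 = k * (d - 2)}) :
    ∃ m : {m : Fin k → Fin (d - 1) // (∑ i, (m i : ℕ)) + d = k * (d - 2)},
      colR d (List.ofFn (fun i => (m.1 i : ℕ))) = [List.ofFn (fun i => (v.1 i : ℕ))] := by
  obtain ⟨L, hLlen, hLle, hLsum, hcol⟩ := covered_all d hd (List.ofFn (fun i => (v.1 i : ℕ)))
    (by simp; omega) (ofFn_entries_le v.1) (by simpa [List.sum_ofFn] using v.2)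
  have hLk : L.length = k := by simpa using hLlen
  obtain ⟨g, hg⟩ := exists_fn_of_list (by omega) L hLk hLle
  refine ⟨⟨g, ?_⟩, ?_⟩
  · have h1 : (List.ofFn (fun i => (g i : ℕ))).sum = ∑ i, (g i : ℕ) := List.sum_ofFn
    rw [hg] at h1
    rw [← h1, hLsum, hLk]
  · show colR d (List.ofFn (fun i => (g i : ℕ))) = _
    rw [hg, hcol]

/-- (γ) INSTANCE — THEOREM K-MODEL, `c′ = 1`, EVERY `k′ = k ≥ 3` and EVERY `d ≥ 5`, over EVERY field: the matrix of
`×δ : B_{s-d} → B_{t-d}` of the model member `F_{d;1,k′}` in the monomial bases (rows = target exponent functions, columns = source exponent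
functions, entry `1` iff the row's exponent list occurs in the anchor's column list `colR` of the column) has FULL ROW RANK:
`Matrix.rank = Fintype.card rows`, i.e. `ρ(F_{d;1,k′}) = dim B_{t-d}` — the anchor's CONSEQUENCE as a kernel theorem. -/
theorem rank_mulDelta_modelNonJumpC1All (K : Type*) [Field K] (k d : ℕ) (hk : 3 ≤ k) (hd : 5 ≤ d) :
    (Matrix.of fun (v : {v : Fin k → Fin (d - 1) // (∑ i, (v i : ℕ)) + 2 = k * (d - 2)})
        (m : {m : Fin k → Fin (d - 1) // (∑ i, (m i : ℕ)) + d = k * (d - 2)}) =>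
      if List.ofFn (fun i => (v.1 i : ℕ)) ∈ colR d (List.ofFn (fun i => (m.1 i : ℕ))) then (1 : K) else 0).rank =
      Fintype.card {v : Fin k → Fin (d - 1) // (∑ i, (v i : ℕ)) + 2 = k * (d - 2)} := by
  refine rank_eq_card_of_covering_unit_cols _ (fun v => (exists_unit_col k d hk hd v).choose) ?_
  intro s i
  have h := (exists_unit_col k d hk hd s).choose_spec
  simp only [Matrix.of_apply, h, List.mem_singleton]
  by_cases hsi : i = s
  · subst hsi; simp
  · have hne : List.ofFn (fun j => (i.1 j : ℕ)) ≠ List.ofFn (fun j => (s.1 j : ℕ)) :=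
      fun heq => hsi (Subtype.ext (eq_of_ofFn_eq heq))
    simp [hne, hsi]

/-- the indicator entry IS the coefficient: on a source monomial the anchor's column list `colR` is empty or a singleton
(`column_unit_or_zero`, `d ≥ 5`), so `[v ∈ colR d m] = (multiplicity of v in colR d m)` in `K`. -/
theorem indicator_eq_count (K : Type*) [Field K] (k d : ℕ) (hd : 5 ≤ d)
    (v : {v : Fin k → Fin (d - 1) // (∑ i, (v i : ℕ)) + 2 = k * (d - 2)})
    (m : {m : Fin k → Fin (d - 1) // (∑ i, (m i : ℕ)) + d = k * (d - 2)}) :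
    (if List.ofFn (fun i => (v.1 i : ℕ)) ∈ colR d (List.ofFn (fun i => (m.1 i : ℕ))) then (1 : K) else 0) =
      ((colR d (List.ofFn (fun i => (m.1 i : ℕ)))).count (List.ofFn (fun i => (v.1 i : ℕ))) : K) := by
  rcases column_unit_or_zero d hd (List.ofFn (fun i => (m.1 i : ℕ))) (ofFn_entries_le m.1)
    (by simpa [List.sum_ofFn] using m.2) with h | ⟨w, h⟩
  · simp [h]
  · rw [h]
    by_cases hv : List.ofFn (fun i => (v.1 i : ℕ)) = w
    · subst hv; simp
    · have h0 : (List.ofFn fun i => (v.1 i : ℕ)) ∉ [w] := by simpa using hv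
      simp [h0, List.count_eq_zero.mpr h0]

/-- the (γ) instance for the COEFFICIENT matrix (entry = multiplicity of the row monomial in `colR` of the column), every field,
`k ≥ 3`, `d ≥ 5`: full row rank. -/
theorem rank_mulDelta_modelNonJumpC1All_count (K : Type*) [Field K] (k d : ℕ) (hk : 3 ≤ k) (hd : 5 ≤ d) :
    (Matrix.of fun (v : {v : Fin k → Fin (d - 1) // (∑ i, (v i : ℕ)) + 2 = k * (d - 2)})
        (m : {m : Fin k → Fin (d - 1) // (∑ i, (m i : ℕ)) + d = k * (d - 2)}) =>
      ((colR d (List.ofFn (fun i => (m.1 i : ℕ)))).count (List.ofFn (fun i => (v.1 i : ℕ))) : K)).rank =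
      Fintype.card {v : Fin k → Fin (d - 1) // (∑ i, (v i : ℕ)) + 2 = k * (d - 2)} := by
  rw [← rank_mulDelta_modelNonJumpC1All K k d hk hd]
  congr 1
  ext v m
  simp only [Matrix.of_apply]
  rw [indicator_eq_count K k d hd v m]

/-! ## Counts: `dim B_{t-d} = k(k+1)/2`, `dim B_{t-d} ≤ dim B_{s-d}`, `ρ = min` -/

/-- `dim B_{t-d} = k(k+1)/2` — the number of target monomials (exponent functions `Fin k → Fin (d-1)` of total degree `k(d-2) - 2`), EVERY `k`
and EVERY `d ≥ 4`: the deficiencies `d-2-v_i` form a function `Fin k → ℕ` of total mass `2`, i.e. a `2`-multiset on `Fin k`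
(`Sym.equivNatSumOfFintype`), counted by stars and bars (`Sym.card_sym_eq_choose`: `(k+1).choose 2`). -/
theorem card_target (k d : ℕ) (hd : 4 ≤ d) :
    Fintype.card {v : Fin k → Fin (d - 1) // (∑ i, (v i : ℕ)) + 2 = k * (d - 2)} = k * (k + 1) / 2 := by
  have e : {v : Fin k → Fin (d - 1) // (∑ i, (v i : ℕ)) + 2 = k * (d - 2)} ≃ {P : Fin k → ℕ // ∑ i, P i = 2} :=
    { toFun := fun v => ⟨fun i => d - 2 - (v.1 i : ℕ), by
        have h := v.2
        have hs : ∑ i, (d - 2 - (v.1 i : ℕ)) + ∑ i, (v.1 i : ℕ) = k * (d - 2) := by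
          rw [← Finset.sum_add_distrib, Finset.sum_congr rfl (fun i _ => Nat.sub_add_cancel
            (show (v.1 i : ℕ) ≤ d - 2 by have := (v.1 i).2; omega))]
          simp
        show ∑ i, (d - 2 - (v.1 i : ℕ)) = 2
        omega⟩
      invFun := fun P => ⟨fun i => ⟨d - 2 - P.1 i, by omega⟩, by
        have hP := P.2
        have hle : ∀ i, P.1 i ≤ 2 := fun i =>
          le_trans (Finset.single_le_sum (f := P.1) (fun j _ => Nat.zero_le _) (Finset.mem_univ i)) hP.le
        have hs : ∑ i, (d - 2 - P.1 i) + ∑ i, P.1 i = k * (d - 2) := by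
          rw [← Finset.sum_add_distrib, Finset.sum_congr rfl (fun i _ => Nat.sub_add_cancel
            (show P.1 i ≤ d - 2 by have := hle i; omega))]
          simp
        show ∑ i, (d - 2 - P.1 i) + 2 = k * (d - 2)
        omega⟩
      left_inv := fun v => by
        apply Subtype.ext; funext i; apply Fin.ext
        have := (v.1 i).2
        simp only
        omega
      right_inv := fun P => by
        apply Subtype.ext; funext i
        have hP := P.2
        have hle : P.1 i ≤ 2 :=
          le_trans (Finset.single_le_sum (f := P.1) (fun j _ => Nat.zero_le _) (Finset.mem_univ i)) hP.le
        simp only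
        omega }
  rw [Fintype.card_congr (e.trans (Sym.equivNatSumOfFintype (Fin k) 2).symm),
    Sym.card_sym_eq_choose, Fintype.card_fin, show k + 2 - 1 = k + 1 by omega, Nat.choose_two_right,
    Nat.add_sub_cancel, mul_comm]

/-- hence the companion's basis of `B_{t-d}` has length `k(k+1)/2` for EVERY `k ≥ 1` and EVERY `d ≥ 4` (`tdim_table` had `k′ = 3, 4`,
`d = 5..8` by `decide`). -/
theorem length_basisL_target (k d : ℕ) (hk : 1 ≤ k) (hd : 4 ≤ d) :
    (basisL d k (tdeg d k)).length = k * (k + 1) / 2 := by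
  have hinj : Function.Injective (fun v : {v : Fin k → Fin (d - 1) // (∑ i, (v i : ℕ)) + 2 = k * (d - 2)} =>
      List.ofFn (fun i => (v.1 i : ℕ))) := fun v w h => Subtype.ext (eq_of_ofFn_eq h)
  have hset : (basisL d k (tdeg d k)).toFinset =
      Finset.univ.image (fun v : {v : Fin k → Fin (d - 1) // (∑ i, (v i : ℕ)) + 2 = k * (d - 2)} =>
        List.ofFn (fun i => (v.1 i : ℕ))) := by
    ext L
    rw [List.mem_toFinset, mem_basisL_target_iff k d hk hd, Finset.mem_image]
    simp
  rw [← List.toFinset_card_of_nodup (basisL_nodup d k _), hset, Finset.card_image_of_injective _ hinj,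
    Finset.card_univ, card_target k d hd]

/-- `dim B_{t-d} ≤ dim B_{s-d}` for every `k ≥ 3`, `d ≥ 5`: full row rank needs at least as many columns as rows (`Matrix.rank_le_card_width`). -/
theorem card_target_le_card_source (k d : ℕ) (hk : 3 ≤ k) (hd : 5 ≤ d) :
    Fintype.card {v : Fin k → Fin (d - 1) // (∑ i, (v i : ℕ)) + 2 = k * (d - 2)} ≤
    Fintype.card {m : Fin k → Fin (d - 1) // (∑ i, (m i : ℕ)) + d = k * (d - 2)} := by
  rw [← rank_mulDelta_modelNonJumpC1All ℚ k d hk hd]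
  exact Matrix.rank_le_card_width _

/-- EVERY field, `k ≥ 3`, `d ≥ 5`: `ρ(F_{d;1,k′}) = min(dim B_{s-d}, dim B_{t-d}) = k(k+1)/2` — the model member attains the largest rank a map
`B_{s-d} → B_{t-d}` can have (no rank deficiency, in contrast with the `k′ = 2` jump family of `UnitColumnRank.rank_lt_min_modelJumpFamily`). -/
theorem rank_eq_min_modelNonJumpC1All (K : Type*) [Field K] (k d : ℕ) (hk : 3 ≤ k) (hd : 5 ≤ d) :
    (Matrix.of fun (v : {v : Fin k → Fin (d - 1) // (∑ i, (v i : ℕ)) + 2 = k * (d - 2)})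
        (m : {m : Fin k → Fin (d - 1) // (∑ i, (m i : ℕ)) + d = k * (d - 2)}) =>
      if List.ofFn (fun i => (v.1 i : ℕ)) ∈ colR d (List.ofFn (fun i => (m.1 i : ℕ))) then (1 : K) else 0).rank =
      min (Fintype.card {m : Fin k → Fin (d - 1) // (∑ i, (m i : ℕ)) + d = k * (d - 2)})
        (Fintype.card {v : Fin k → Fin (d - 1) // (∑ i, (v i : ℕ)) + 2 = k * (d - 2)}) ∧
    min (Fintype.card {m : Fin k → Fin (d - 1) // (∑ i, (m i : ℕ)) + d = k * (d - 2)})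
        (Fintype.card {v : Fin k → Fin (d - 1) // (∑ i, (v i : ℕ)) + 2 = k * (d - 2)}) = k * (k + 1) / 2 := by
  rw [rank_mulDelta_modelNonJumpC1All K k d hk hd, min_eq_right (card_target_le_card_source k d hk hd),
    card_target k d (by omega)]
  exact ⟨rfl, rfl⟩

/-- small re-evaluations (`decide`): `dim B_{t-d} = 6, 6, 10` for `(k, d) = (3, 5), (3, 6), (4, 5)` — the values `k(k+1)/2` of `card_target`
and of the companion's `tdim_table`. -/
theorem card_target_examples :
    Fintype.card {v : Fin 3 → Fin (5 - 1) // (∑ i, (v i : ℕ)) + 2 = 3 * (5 - 2)} = 6 ∧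
    Fintype.card {v : Fin 3 → Fin (6 - 1) // (∑ i, (v i : ℕ)) + 2 = 3 * (6 - 2)} = 6 ∧
    Fintype.card {v : Fin 4 → Fin (5 - 1) // (∑ i, (v i : ℕ)) + 2 = 4 * (5 - 2)} = 10 := by
  refine ⟨by decide, by decide, by decide⟩

end Summit.HodgeConjecture.HodgeConjecture.HodgeLocus.Census.UnitColumnRankC1All
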